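import Mathlib
import Literature.Analysis.ODE.LiouvilleGreenVolterraBound
import Summits.NavierStokesRegularity.NavierStokesRegularity.Theorems.TaoLadderRungTwoBreakOneShiftMapDefs
import HarnessLib

/-!
# Fixed point of the one-shift map on trajectory space ⟹ ball datum ⟹ surviving admissible DSS wave
# (cell harvest/h2-tao-ladder, seat p2; kernel STAGE 3, step (5) of rung1/KERNEL-STAGE3-PLAN.md; support for
# K1(1) = `NoSurvivingDSSOne`, stmt-NavierStokesRegularity-20205)

MODEL lattice ODEs only (Tao 2016 §4 on Tao's shift set `S`); nothing here is a statement about the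
Navier–Stokes equations; no item is closed; CONDITIONAL glue.

`…OneShiftMapDefs` (p620787) defines the one-shift renormalisation map `oneShiftMap cert` on the Banach space
`Space` of (scaled window start state, flight time, tail trajectories), over a window certificate `cert`
(p1's `WindowRun` on `S` + the Krawczyk map's fixed-point characterisation). This file UNPACKS a fixed point:
`exists_surviving_dssWave_of_fixedPoint` — an admissible fixed point at which the clamps are inactive (raw
window output in the box, raw tail outputs in their tubes: the STAGE-2 self-map inequalities), with
renormalisation factor `1 < g⋆² ≤ 1 + ε₀`, `g⋆ < Λ`, wake tubes under `Q βⁿ` (`β² < g⋆Λ`), top tubes under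
`C₀ ϱ^{W+j}` (`ϱΛ < 1`), a bound `Q` on the bottom window shell along the flight and a window-bottom box
interval avoiding `0`, yields `∃ T > 0, ∃ Φ, IsDSSWave ε₀ α (Equiv.refl Unit) T Φ ∧ Surviving 1 ε₀ T ∧ Φ ≢ 0`.
Inside: the tail coordinates of the fixed point equal their Picard–shift images, so every tail shell solves
the lattice on the flight (fundamental theorem of calculus, tree lemma
`Literature.Analysis.ODE.hasDerivWithinAt_integral_Icc`) and starts at `g⋆ ×` the next shell's end value; the
window shells solve it by `Φ_run` and satisfy the one-shift relations by `Nmap_fixed`; window shells are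
bounded on the compact flight; then `exists_surviving_dssWave_of_quadTermBallDatum` (p619300). What remains for
the full kernel STAGE 3 after this file: MapsTo + ContractingWith of `oneShiftMap` on `Adm` from the engine's
(H-win)/(H-lip) constants (steps (2)–(4) of the plan) — they PRODUCE the fixed point assumed here.
-/

noncomputable section

-- `Summit.NavierStokesRegularity.NavierStokesRegularity.…` is the tree's (summit = problem) namespace; the
-- duplicated component is intended, so the dupNamespace linter is silenced for this file.
set_option linter.dupNamespace false

namespace Summit.NavierStokesRegularity.NavierStokesRegularity.Theorems

namespace DSSOneShift

open Set MeasureTheory intervalIntegral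
open Literature.Analysis.FluidPDE Literature.Analysis.FluidPDE.TaoCascade CertificateGlueOn

variable {m : ℕ}

namespace OneShiftFrame

variable (F : OneShiftFrame m)

/-! ### Fixed point ⟹ one-shift ball datum ⟹ surviving DSS wave -/

/-- The nonlinearity is continuous in time along a family all of whose shells are continuous.
[cite: Tao2016AveragedNS, §4 (4.8); folklore] -/
theorem continuousOn_quadTerm {ε₀ : ℝ} {α : Fin m → Fin m → Fin m → ℤ × ℤ × ℤ → ℝ}
    {X : Fin m → ℤ → ℝ → ℝ} {I : Set ℝ} (hX : ∀ j k, ContinuousOn (X j k) I) (i : Fin m) (n : ℤ) :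
    ContinuousOn (fun t => quadTerm ε₀ α X i n t) I := by
  unfold quadTerm
  refine continuousOn_finsetSum _ fun i₁ _ => continuousOn_finsetSum _ fun i₂ _ =>
    continuousOn_finsetSum _ fun μ _ => ?_
  exact continuousOn_const.mul ((hX _ _).mul (hX _ _))

/-- Pre-clamping is the identity on ALL tail coordinates of an admissible point (window-indexed tail
coordinates are zero on both sides). [folklore] -/
theorem preclampTail_eq_decodeTail_fun {u : F.Space} (hu : F.Adm u) :
    F.preclampTail u = F.decodeTail u := by
  funext i k t
  by_cases hk : F.InWindow k
  · simp only [preclampTail, decodeTail, clampTail, if_pos hk, hu.2.2.2.2 i k hk, mul_zero]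
  · exact F.preclampTail_eq_decodeTail hu i hk t

/-- The decoded data of an admissible point are admissible window-system data. [folklore] -/
theorem admData_decode {u : F.Space} (hu : F.Adm u) : F.AdmData (F.decodeY u) (F.decodeTail u) := by
  refine ⟨fun i k hk => ?_, fun i k hk => hu.2.2.1 i k hk, fun i k hk => hu.2.2.2.1 i k hk⟩
  unfold decodeY
  rw [dif_pos hk]
  have ha := F.a_pos i k
  have h1 := hu.1 i ⟨k.toNat, by have := hk.1; have := hk.2; omega⟩
  rw [show F.yc i k + F.a i k * u.1 i ⟨k.toNat, _⟩ - F.yc i k = F.a i k * u.1 i ⟨k.toNat, by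
      have := hk.1; have := hk.2; omega⟩ by ring, abs_mul, abs_of_pos ha]
  nlinarith

/-- **FIXED POINT OF THE ONE-SHIFT MAP ⟹ NON-TRIVIAL (S₁)-SURVIVING ADMISSIBLE DSS WAVE.** Let `u` be an
admissible fixed point of `oneShiftMap cert` at which the clamps are inactive (the raw window output lies in
the box and the raw tail outputs lie in their tubes — what the STAGE-2 self-map inequalities give), let the
table be bounded (`|α| ≤ M_α`), let the fixed point's renormalisation factor `g⋆ = gfac(z)` satisfy
`1 < g⋆² ≤ 1 + ε₀`, `g⋆ < Λ`, let the wake tubes be dominated by `Q βⁿ` (`β ≥ 1`, `β² < g⋆Λ`), the top tubes by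
`C₀ ϱ^{W+j}` (`0 < ϱ`, `ϱΛ < 1`), the bottom window shell by `Q` along the flight, and let some window-bottom
box interval avoid `0`. Then the table carries a non-trivial admissible one-profile DSS wave with delay
`T = log(Λ/g⋆) > 0` that is (S₁)-surviving. PROOF: unpack the fixed-point equation coordinatewise (clamps
inactive): the tails equal their Picard–shift images, so every tail shell solves the lattice on the flight
(fundamental theorem of calculus) and starts at `g⋆ ×` the next shell's end value; the window shells solve the
lattice by `Φ_run` (p1's `WindowRun` on `S`) and satisfy the one-shift relations and the section by
`Nmap_fixed`; the resulting family on `[0, τ⋆]` is a ball datum, and `exists_surviving_dssWave_of_quadTermBallDatum`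
(p619300) applies. [cite: Tao2016AveragedNS, §4 Lemma 4.1 (4.8), §5.3–§6; cell vocabulary, harvest/h2-tao-ladder rung1/STAGE3-BANACH.md (the fixed point), rung1/KERNEL-STAGE3-PLAN.md §1] -/
theorem exists_surviving_dssWave_of_fixedPoint {ε₀ Mα Q β C₀ ϱ : ℝ}
    {α : Fin m → Fin m → Fin m → ℤ × ℤ × ℤ → ℝ} (cert : OneShiftWindowCert F ε₀ α)
    (hε : 0 < 1 + ε₀) (hMα : 0 ≤ Mα) (hα : ∀ i₁ i₂ i₃ μ, |α i₁ i₂ i₃ μ| ≤ Mα) (hW : 1 ≤ F.W)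
    {u : F.Space} (hu : F.Adm u) (hfix : F.oneShiftMap cert u = u)
    (hrawY : ∀ i (k : Fin F.W),
      |((cert.Nmap (F.decodeTail u) (F.decodeY u, F.decodeTau u)).1 i k - F.yc i k) / F.a i k| ≤ 1)
    (hrawτ : |((cert.Nmap (F.decodeTail u) (F.decodeY u, F.decodeTau u)).2 - F.τc) / F.rτ| ≤ 1)
    (hrawT : ∀ i k, ¬ F.InWindow k → ∀ t ∈ Icc 0 F.τhi,
      |F.tailRaw cert u i k t - F.tubeC i k| ≤ F.tubeR k)
    (hg1 : 1 < gfac (slice (F.fullFamily cert u) (F.decodeTau u)) ^ 2)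
    (hg2 : gfac (slice (F.fullFamily cert u) (F.decodeTau u)) ^ 2 ≤ 1 + ε₀)
    (hgΛ : gfac (slice (F.fullFamily cert u) (F.decodeTau u)) < bigLam ε₀)
    (hQ : 0 ≤ Q) (hβ1 : 1 ≤ β) (hr : β ^ 2 < gfac (slice (F.fullFamily cert u) (F.decodeTau u)) * bigLam ε₀)
    (hwakeTube : ∀ i (n : ℕ), 1 ≤ n → |F.tubeC i (-(n : ℤ))| + F.tubeR (-(n : ℤ)) ≤ Q * β ^ n)
    (hhull0 : ∀ i, ∀ s ∈ Icc 0 F.τhi, |F.fullFamily cert u i 0 s| ≤ Q)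
    (hϱ : 0 < ϱ) (hϱ1 : ϱ * bigLam ε₀ < 1) (hC₀ : 0 ≤ C₀)
    (htopTube : ∀ i (j : ℕ), |F.tubeC i ((F.W : ℤ) + j)| + F.tubeR ((F.W : ℤ) + j) ≤ C₀ * ϱ ^ (F.W + j))
    (hne : ∃ i, F.a i 0 < |F.yc i 0|) :
    ∃ (T : ℝ) (Φ : Unit → ℝ → Em m), 0 < T ∧ IsDSSWave ε₀ α (Equiv.refl Unit) T Φ ∧ Surviving 1 ε₀ T ∧
      ∃ x, Φ () x ≠ 0 := by
  -- names
  set y := F.decodeY u with hy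
  set τs := F.decodeTau u with hτs
  set T := F.decodeTail u with hTdef
  set S := F.fullFamily cert u with hS
  set g := gfac (slice S τs) with hgdef
  have hpreY : F.preclampY u = y := F.preclampY_eq_decodeY hu
  have hpreτ : F.preclampTau u = τs := F.preclampTau_eq_decodeTau hu
  have hpreT : F.preclampTail u = T := F.preclampTail_eq_decodeTail_fun hu
  have hSdef : S = cert.Φ y T := by rw [hS]; unfold fullFamily; rw [hpreY, hpreT]
  have hAdm : F.AdmData y T := F.admData_decode hu
  have hrun := cert.Φ_run y T hAdm
  rw [← hSdef] at hrun
  -- the flight time lies in `[τc - rτ, τc + rτ] ⊆ (0, τhi]`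
  have hτmem : τs ∈ Icc (F.τc - F.rτ) (F.τc + F.rτ) := by
    have h := hu.2.1; rw [abs_le] at h
    have hr := F.rτ_pos
    constructor <;> · rw [hτs]; unfold decodeTau; nlinarith
  have hτpos : 0 < τs := by have := F.τc_gt; linarith [hτmem.1]
  have hτle : τs ≤ F.τhi := by unfold τhi; exact hτmem.2
  have hsub : Icc 0 τs ⊆ Icc 0 F.τhi := Icc_subset_Icc_right hτle
  -- continuity of every shell of `S` on the flight
  have hcontS : ∀ j k, ContinuousOn (S j k) (Icc 0 F.τhi) := by
    intro j k
    by_cases hk : F.InWindow k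
    · exact hrun.continuousOn j hk.1 (by have := hk.2; omega)
    · rw [hSdef, cert.Φ_tail y T j k hk]; exact hAdm.2.1 j k hk
  have hcontQ : ∀ i k, ContinuousOn (fun t => quadTerm ε₀ α S i k t) (Icc 0 F.τhi) :=
    fun i k => continuousOn_quadTerm hcontS i k
  -- TAIL SHELLS: the fixed-point equation says `T_{i,k}(t) = g S_{i,k+1}(τ⋆) + ∫_0^t quadTerm`
  have htailEq : ∀ i k, ¬ F.InWindow k → ∀ t ∈ Icc 0 F.τhi,
      S i k t = g * S i (k + 1) τs + ∫ s in (0 : ℝ)..t, quadTerm ε₀ α S i k s := by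
    intro i k hk t ht
    have hST : S i k t = T i k t := by rw [hSdef, cert.Φ_tail y T i k hk]
    have hfixT : ((F.oneShiftMap cert u).2.2 : F.TailIdx → ℝ) (i, k, ⟨t, ht⟩) =
        (u.2.2 : F.TailIdx → ℝ) (i, k, ⟨t, ht⟩) := by rw [hfix]
    rw [F.oneShiftMap_tail_apply] at hfixT
    -- the clamp is inactive
    have hraw := hrawT i k hk t ht
    have hin : F.clampTail i k (F.tailRaw cert u i k t / F.wt k) = F.tailRaw cert u i k t / F.wt k :=
      F.clampTail_of_mem hk (by rwa [mul_div_cancel₀ _ (F.wt_pos k).ne'])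
    rw [hin] at hfixT
    -- decode
    have hTt : T i k t = F.wt k * (u.2.2 : F.TailIdx → ℝ) (i, k, ⟨t, ht⟩) := by
      rw [hTdef]; unfold decodeTail; rw [projIcc_of_mem _ ht]
    rw [hST, hTt, ← hfixT, mul_div_cancel₀ _ (F.wt_pos k).ne']
    unfold tailRaw
    rw [hpreτ]
  -- hence every tail shell solves the lattice on the flight
  have htailDeriv : ∀ i k, ¬ F.InWindow k → ∀ t ∈ Icc 0 F.τhi,
      HasDerivWithinAt (S i k) (quadTerm ε₀ α S i k t) (Icc 0 F.τhi) t := by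
    intro i k hk t ht
    have hprim := Literature.Analysis.ODE.hasDerivWithinAt_integral_Icc (hcontQ i k) ht
    have h2 : HasDerivWithinAt (fun x => g * S i (k + 1) τs + ∫ s in (0 : ℝ)..x, quadTerm ε₀ α S i k s)
        (quadTerm ε₀ α S i k t) (Icc 0 F.τhi) t := by
      simpa using hprim.const_add (g * S i (k + 1) τs)
    exact h2.congr (fun x hx => htailEq i k hk x hx) (htailEq i k hk t ht)
  -- WINDOW SHELLS: `Φ_run` (p1's `WindowRun` on `S`)
  have hwinDeriv : ∀ i k, F.InWindow k → ∀ t ∈ Icc 0 F.τhi,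
      HasDerivWithinAt (S i k) (quadTerm ε₀ α S i k t) (Icc 0 F.τhi) t := by
    intro i k hk t ht
    have h := hrun.deriv i k hk.1 (by have := hk.2; omega) t ht
    rwa [quadTermOn_shiftSet] at h
  have hderiv : ∀ i k, ∀ t ∈ Icc 0 τs,
      HasDerivWithinAt (S i k) (quadTerm ε₀ α S i k t) (Icc 0 τs) t := by
    intro i k t ht
    by_cases hk : F.InWindow k
    · exact (hwinDeriv i k hk t (hsub ht)).mono hsub
    · exact (htailDeriv i k hk t (hsub ht)).mono hsub
  -- the Krawczyk block: clamps inactive ⟹ `Nmap T (y, τ⋆) = (y, τ⋆)`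
  have hNfix : cert.Nmap T (y, τs) = (y, τs) := by
    set out := cert.Nmap T (y, τs) with hout
    have hwo : (F.windowOut cert u).1 = u.1 := congrArg Prod.fst hfix
    have hτo : (F.windowOut cert u).2 = u.2.1 := congrArg (fun v : F.Space => v.2.1) hfix
    unfold windowOut at hwo hτo
    rw [hpreT, hpreY, hpreτ] at hwo hτo
    simp only at hwo hτo
    refine Prod.ext ?_ ?_
    · funext i k
      change out.1 i k = y i k
      by_cases hk : F.InWindow k
      · have hk' : k.toNat < F.W := by have := hk.1; have := hk.2; omega
        have hcomp := congrFun (congrFun hwo i) ⟨k.toNat, hk'⟩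
        have hkk : ((⟨k.toNat, hk'⟩ : Fin F.W) : ℤ) = k := by simp [Int.toNat_of_nonneg hk.1]
        rw [hkk, clampUnit_of_abs_le (by simpa [hkk] using hrawY i ⟨k.toNat, hk'⟩)] at hcomp
        -- `(out.1 i k - yc)/a = ũ i k` and `y i k = yc + a ũ i k`
        have hyk : y i k = F.yc i k + F.a i k * u.1 i ⟨k.toNat, hk'⟩ := by
          rw [hy]; unfold decodeY; rw [dif_pos hk]
        rw [hyk, ← hcomp]
        field_simp [(F.a_pos i k).ne']
        ring
      · rw [cert.Nmap_support T y τs i k hk]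
        rw [hy]; unfold decodeY; rw [dif_neg hk]
    · change out.2 = τs
      rw [clampUnit_of_abs_le hrawτ] at hτo
      rw [hτs]; unfold decodeTau; rw [← hτo]
      field_simp [F.rτ_pos.ne']
      ring
  have hyoff : ∀ i k, ¬ F.InWindow k → y i k = 0 := fun i k hk => by
    rw [hy]; unfold decodeY; rw [dif_neg hk]
  obtain ⟨hwin1, hwin2, _hsec⟩ := cert.Nmap_fixed y T τs hAdm hyoff hτmem hNfix
  rw [← hSdef] at hwin1 hwin2
  -- ONE-SHIFT RELATION on every shell
  have hshift : ∀ i (k : ℤ), g * S i (k + 1) τs = S i k 0 := by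
    intro i k
    by_cases hk : F.InWindow k
    · by_cases hk1 : k + 1 < F.W
      · rw [hgdef, hwin1 i k hk.1 hk1, hSdef, cert.Φ_init y T hAdm i k hk]
      · -- top window shell `k = W - 1`
        have hkW : k = (F.W : ℤ) - 1 := by have := hk.2; omega
        have hT : S i (k + 1) τs = T i F.W τs := by
          rw [hSdef, cert.Φ_tail y T i (k + 1) (by unfold InWindow; omega)]
          congr 1; omega
        rw [hT, hgdef, hwin2 i, ← hkW, hSdef, cert.Φ_init y T hAdm i k hk]
    · have h0 : (0 : ℝ) ∈ Icc 0 F.τhi := left_mem_Icc.2 F.τhi_pos.le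
      rw [htailEq i k hk 0 h0, intervalIntegral.integral_same, add_zero]
  -- BALL DATA on `[0, τ⋆]`
  have hwake : ∀ (n : ℕ) (s : ℝ), s ∈ Icc 0 τs → ∀ i, |S i (-(n : ℤ)) s| ≤ Q * β ^ n := by
    intro n s hs i
    rcases Nat.eq_zero_or_pos n with rfl | hn
    · simpa using hhull0 i s (hsub hs)
    · have hk : ¬ F.InWindow (-(n : ℤ)) := by unfold InWindow; omega
      have hST : S i (-(n : ℤ)) s = T i (-(n : ℤ)) s := by rw [hSdef, cert.Φ_tail y T i _ hk]
      have htube := hAdm.2.2 i (-(n : ℤ)) hk s (hsub hs)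
      rw [hST]
      have := hwakeTube i n hn
      have h3 : |T i (-(n : ℤ)) s| ≤ |F.tubeC i (-(n : ℤ))| + F.tubeR (-(n : ℤ)) := by
        have := abs_sub_abs_le_abs_sub (T i (-(n : ℤ)) s) (F.tubeC i (-(n : ℤ)))
        linarith
      linarith
  -- window shells are bounded on the flight (compactness); top shells by their tubes
  have hwinBdd : ∀ i k, F.InWindow k → ∃ C, 0 ≤ C ∧ ∀ s ∈ Icc 0 F.τhi, |S i k s| ≤ C := by
    intro i k hk
    obtain ⟨C, hC⟩ := (isCompact_Icc : IsCompact (Icc (0 : ℝ) F.τhi)).exists_bound_of_continuousOn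
      (hcontS i k)
    refine ⟨max C 0, le_max_right _ _, fun s hs => ?_⟩
    exact ((Real.norm_eq_abs _).symm.le.trans (hC s hs)).trans (le_max_left _ _)
  choose Cw hCw0 hCw using hwinBdd
  -- a single top constant: `C_t := C₀ + Σ_{i, k < W} Cw i k / ϱ^k`
  obtain ⟨Ct, hCt0, hCt⟩ : ∃ Ct : ℝ, 0 ≤ Ct ∧
      ∀ (n : ℕ) (s : ℝ), s ∈ Icc 0 τs → ∀ i, |S i (n : ℤ) s| ≤ Ct * ϱ ^ n := by
    classical
    let cw : Fin m → Fin F.W → ℝ := fun i k => Cw i (k : ℤ) ⟨by omega, by omega⟩ / ϱ ^ (k : ℕ)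
    have hcw0 : ∀ i k, 0 ≤ cw i k := fun i k => div_nonneg (hCw0 _ _ _) (pow_nonneg hϱ.le _)
    refine ⟨C₀ + ∑ i, ∑ k, cw i k, ?_, ?_⟩
    · have : 0 ≤ ∑ i, ∑ k, cw i k := Finset.sum_nonneg fun i _ => Finset.sum_nonneg fun k _ => hcw0 i k
      linarith
    intro n s hs i
    by_cases hn : n < F.W
    · -- window shell
      have hk : F.InWindow (n : ℤ) := ⟨by omega, by exact_mod_cast hn⟩
      have hb := hCw i (n : ℤ) hk s (hsub hs)
      have hle : Cw i (n : ℤ) hk ≤ (∑ i', ∑ k, cw i' k) * ϱ ^ n := by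
        have hterm : cw i ⟨n, hn⟩ ≤ ∑ i', ∑ k, cw i' k := by
          have h1 : cw i ⟨n, hn⟩ ≤ ∑ k, cw i k :=
            Finset.single_le_sum (f := fun k => cw i k) (fun k _ => hcw0 i k) (Finset.mem_univ _)
          exact h1.trans (Finset.single_le_sum (f := fun i' => ∑ k, cw i' k)
            (fun i' _ => Finset.sum_nonneg fun k _ => hcw0 i' k) (Finset.mem_univ i))
        have hpos : 0 < ϱ ^ n := pow_pos hϱ n
        have : cw i ⟨n, hn⟩ * ϱ ^ n = Cw i (n : ℤ) hk := by
          show Cw i ((⟨n, hn⟩ : Fin F.W) : ℤ) _ / ϱ ^ ((⟨n, hn⟩ : Fin F.W) : ℕ) * ϱ ^ n = _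
          rw [div_mul_cancel₀ _ hpos.ne']
        rw [← this]
        exact mul_le_mul_of_nonneg_right hterm hpos.le
      calc |S i (n : ℤ) s| ≤ Cw i (n : ℤ) hk := hb
        _ ≤ (∑ i', ∑ k, cw i' k) * ϱ ^ n := hle
        _ ≤ (C₀ + ∑ i', ∑ k, cw i' k) * ϱ ^ n := by
            gcongr; linarith
    · -- top shell `n = W + j`
      obtain ⟨j, rfl⟩ : ∃ j, n = F.W + j := ⟨n - F.W, by omega⟩
      have hk : ¬ F.InWindow ((F.W : ℤ) + j) := by unfold InWindow; omega
      have hST : S i (((F.W + j : ℕ) : ℤ)) s = T i ((F.W : ℤ) + j) s := by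
        rw [hSdef, show (((F.W + j : ℕ) : ℤ)) = (F.W : ℤ) + j by push_cast; ring,
          cert.Φ_tail y T i _ hk]
      have htube := hAdm.2.2 i ((F.W : ℤ) + j) hk s (hsub hs)
      have h3 : |T i ((F.W : ℤ) + j) s| ≤ |F.tubeC i ((F.W : ℤ) + j)| + F.tubeR ((F.W : ℤ) + j) := by
        have := abs_sub_abs_le_abs_sub (T i ((F.W : ℤ) + j) s) (F.tubeC i ((F.W : ℤ) + j))
        linarith
      rw [hST]
      have hsum0 : 0 ≤ ∑ i', ∑ k, cw i' k := Finset.sum_nonneg fun i _ => Finset.sum_nonneg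
        fun k _ => hcw0 i k
      calc |T i ((F.W : ℤ) + j) s| ≤ C₀ * ϱ ^ (F.W + j) := (h3.trans (htopTube i j))
        _ ≤ (C₀ + ∑ i', ∑ k, cw i' k) * ϱ ^ (F.W + j) := by
            gcongr; linarith
  -- non-zero start shell
  have hne' : ∃ s ∈ Ico 0 τs, ∃ i, S i 0 s ≠ 0 := by
    obtain ⟨i, hi⟩ := hne
    refine ⟨0, ⟨le_rfl, hτpos⟩, i, ?_⟩
    have h0 : F.InWindow 0 := ⟨le_rfl, by exact_mod_cast hW⟩
    rw [hSdef, cert.Φ_init y T hAdm i 0 h0, hy]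
    unfold decodeY
    rw [dif_pos h0]
    intro h
    have hb := hu.1 i ⟨(0 : ℤ).toNat, by simp; omega⟩
    have : |F.yc i 0| ≤ F.a i 0 := by
      have e : F.yc i 0 = -(F.a i 0 * u.1 i ⟨(0 : ℤ).toNat, by simp; omega⟩) := by linarith
      rw [e, abs_neg, abs_mul, abs_of_pos (F.a_pos i 0)]
      nlinarith [F.a_pos i 0]
    linarith
  -- the delay and the blow-up time
  have hΛpos : 0 < bigLam ε₀ := bigLam_pos (by linarith)
  have hgpos : 0 < g := by
    have : 0 ≤ g := by rw [hgdef]; unfold gfac; positivity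
    rcases this.eq_or_lt with h | h
    · rw [← h] at hg1; norm_num at hg1
    · exact h
  set Td := Real.log (bigLam ε₀ / g) with hTd
  have hTd_pos : 0 < Td := Real.log_pos ((one_lt_div hgpos).2 hgΛ)
  have hlam : bigLam ε₀ = g * Real.exp Td := by
    rw [hTd, Real.exp_log (div_pos hΛpos hgpos)]; field_simp
  have h1e : 0 < 1 - Real.exp (-Td) := by
    have : Real.exp (-Td) < 1 := by rw [← Real.exp_zero]; exact Real.exp_lt_exp.2 (by linarith)
    linarith
  set tstar := τs / (1 - Real.exp (-Td)) with htstar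
  have htstar' : τs = tstar * (1 - Real.exp (-Td)) := by rw [htstar]; field_simp
  obtain ⟨Φ, hΦ, hSurv, hx⟩ := exists_surviving_dssWave_of_quadTermBallDatum hε hMα hα hgpos hTd_pos
    hlam hτpos htstar' hderiv hshift hQ hβ1 hr hwake hϱ.le hϱ1 hCt hg1 hg2 hne'
  exact ⟨Td, Φ, hTd_pos, hΦ, hSurv, hx⟩


end OneShiftFrame

end DSSOneShift

end Summit.NavierStokesRegularity.NavierStokesRegularity.Theorems
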